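import Summits.QuantumFields.BalabanUV.Beta.FP.PerfectPolarizationZerothMoment
import Summits.QuantumFields.BalabanUV.Beta.FP.PerfectPolarizationReflection
import Summits.QuantumFields.BalabanUV.Beta.FP.RemainderLedgerCov
import Literature.MathematicalPhysics.QuantumFieldTheory.Balaban1983to89.B12Normalization

/-!
# `BalabanUV.Beta.FP.PerfectAsymptoticsBF` — road «FP» for binder row D1, the γ-END AT THE EXPLICIT KERNEL (owner capstone of leaf (H2)):
# (ASYMP) FOR THE PERFECT COLUMNS, `K := PiBF`, MODULO `hsplit` (KER-γ) AND THE PIECE LEDGER (rem) — all four K-letters of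
# `RemainderLedgerCov.hasym_perfect_of_pieces_cov` DISCHARGED BY NAME: (K6) `sextic_PiBF` ✓, (Kcov) `axisReflectionCovariant_flipK_PiBF` ✓,
# (K0) `hK0_PiBF` ✓, `hgerm` `hgerm_PiBF` ✓; conclusion in Bałaban's units: `|secondMoment (T m) μ ν − m·stepBal N Lc| ≤ (U₀ + Σ B i) + Cg`

HONEST DEPENDENCY (page 1, mandatory): continuum YM on T⁴ ⇐ BetaPertH ∧ nine spine estimates (0/9 proved); BetaPertH ⇐ (D1) ∧ (D4) ∧
CAP+tail; G-an2-4 gates asym, D1 and NE2/3/4.  HONEST FRAMING (cell contract, verbatim): «discharging `BetaPertH` makes Bałaban's UV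
stability UNCONDITIONAL — a real constructive-QFT result; it is NOT the continuum limit and NOT the Clay problem.»  THIS MODULE composes BY NAME: leaf-01-g10's cov
re-cut END `RemainderLedgerCov.hasym_perfect_of_pieces_cov` ✓ (R-FP-32 (R2)), the owner's H2-ASM-5 modules C∕D∕E, leaf-02-g9's (Kcov) `PerfectPolarizationReflection` ✓,
gan24-leaf-02-g39's Ward half ✓, and `B12Normalization.stepBal_eq` [Balaban1987RG1 (0.20) p.256, a DEFINITION's closed form].  WHAT REMAINS HYPOTHESIS, DISPLAYED:
(i) the vertex data of the PERFECT ACTION as an admissible family — letters (a1)–(a4), (a7)∕(a8) = bi-localisation, covariance, zero mass, Ward generator tables `X`∕`Xg`,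
bond-reflection laws, (W-loc), and the germ identities H2V-1∕2∕3 (`cubicGermOf V = cQ•bfGerm`, `cubicGermOfSc v = ghostGerm`) — row H2V-4; (ii) an3's colour weights as the
TOTAL colour equation; (iii) **`hsplit`** — the sandwich∕split of the perfect second-moment table `T m` against the dressed truncated transport of `K` into finitely many
pieces (KER-γ (α)(γ)); (iv) **`hpieces`** — the m-free weighted `ℓ¹` bounds of the pieces (the (rem) ledger: RHOA∕GAMMA∕MIX instances).  No `def`, no `def … : Prop`,
nothing cited as a fact, 0 sorry.  WHAT IT IS NOT: not `hsplit`, not the piece ledger, hence NOT (ASYMP), NOT `FixedPointIdentification`'s `hasym`, NOT D1; 0∕4 row-D1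
binders; NOT BetaPertH, NOT continuum, NOT Clay.

ABSOLUTE RULE (cell charter, verbatim): «No internally-minted statement may enter as a cited fact. Every hypothesis is either kernel-proved in this
package or a verbatim quotation of a PUBLISHED theorem with page reference. The manuscript(s) under audit are NOT citable for their own disputed
steps — they are the thing under adjudication; programme-internal (2001/route/tribunal) claims are never citable.»

Provenance: road FP OWNER b2b-balaban-beta-d1-p3 gen 8 (prover-b2b-balaban-beta-d1-p3-g8-0), 2026-08-21, γ-END capstone at `K := PiBF`; «not in print; our bookkeeping».
-/

noncomputable section

namespace Summit.QuantumFields.BalabanUV.Beta.FP.PerfectAsymptoticsBF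

open Finset
open scoped BigOperators
open Literature.Probability.LatticeModels (box annulus)
open Literature.MathematicalPhysics.QuantumFieldTheory.Balaban1983to89
open Literature.MathematicalPhysics.QuantumFieldTheory.Balaban1983to89.Beta
open Literature.MathematicalPhysics.QuantumFieldTheory.Balaban1983to89.Beta.BubbleTransfer (c4)
open Literature.MathematicalPhysics.QuantumFieldTheory.Balaban1983to89.B12Normalization (stepBal stepBal_eq)
open B12Sec2to5 (l1)
open PolarizationSign (WardTransversal AxisReflectionCovariant reflSign)
open ExpKernelCalculus (Site MKer BiLoc comp shiftK)
open OneStepResolventKernel (Fib LocStencil)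
open OneStepKernelFamily (flipK)
open KernelWard (divV divW)
open KernelReflection (LegMap refK bondRefl)
open DyadicShell (Pt supNorm)
open DressedMomentNormalisation (EKer dressedEntry)
open LeadingCoefficient (kappaBal)
open Summit.QuantumFields.BalabanUV.Beta.GAN24.CombesThomas (sfStep smStep)
open Summit.QuantumFields.BalabanUV.Beta.FP.PerfectObjectsT (KPerf)
open Summit.QuantumFields.BalabanUV.Beta.FP.TransportInfinityM (colOf)
open Summit.QuantumFields.BalabanUV.Beta.FP.HorizontalBookkeeping (truncK)
open Summit.QuantumFields.BalabanUV.Beta.FP.WilsonCubicGerm (cubicGermOf)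
open Summit.QuantumFields.BalabanUV.Beta.FP.GhostCubicGerm (cubicGermOfSc)
open Summit.QuantumFields.BalabanUV.Beta.FP.BubbleGermValue (bfGerm ghostGerm)
open Summit.QuantumFields.BalabanUV.Beta.FP.PerfectPolarization (Pker G0ker PiBF)
open Summit.QuantumFields.BalabanUV.Beta.FP.PerfectPolarizationGerm (hgerm_PiBF)
open Summit.QuantumFields.BalabanUV.Beta.FP.PerfectPolarizationDecay (sextic_PiBF)
open Summit.QuantumFields.BalabanUV.Beta.FP.PerfectPolarizationZerothMoment (hK0_PiBF)
open Summit.QuantumFields.BalabanUV.Beta.FP.PerfectPolarizationReflection (axisReflectionCovariant_flipK_PiBF)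
open Summit.QuantumFields.BalabanUV.Beta.FP.RemainderLedgerCov (hasym_perfect_of_pieces_cov)

/-- **(ASYMP) AT THE EXPLICIT KERNEL, MODULO `hsplit` AND THE PIECE LEDGER** [our object] (the γ-END capstone of road «FP» at `K := PiBF wg wgh V W v w`).
Hypotheses: the admissible-family letters of both sectors (bi-localisation with ONE cubic constant `Cv`, translation covariance, total zero mass, Ward generator
tables (W1)∕(W2), bond-reflection laws, (W-loc)), the germ identities (H2V-1∕2∕3), the total colour equation (H2-ASM-4), `μ ≠ ν`, `2 ≤ Lc`; the split `hsplit` of the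
perfect second-moment table against the dressed truncated transport of `PiBF` into pieces `D i` (KER-γ) with m-free weighted-`ℓ¹` bounds `B i` (the (rem) ledger).
THEN `∃ U₀ ≥ 0, ∃ Cg, ∀ m ≥ 1, |secondMoment (T m) μ ν − m·stepBal N Lc| ≤ (U₀ + Σ_{i∈I} B i) + Cg` — `hasym_perfect_of_pieces_cov` with its four K-letters
discharged by `sextic_PiBF`, `axisReflectionCovariant_flipK_PiBF`, `hK0_PiBF`, `hgerm_PiBF`, and `stepBal_eq`. -/
theorem hasym_PiBF_of_pieces {Lc : ℕ} [NeZero Lc] (hLc : 2 ≤ Lc) (wg wgh : ℝ)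
    {V : Fin 4 → Site 4 → MKer 4 (Fib 3)} {W : Fin 4 → Site 4 → Fin 4 → Site 4 → MKer 4 (Fib 3)}
    {v : Fin 4 → Site 4 → MKer 4 Unit} {w : Fin 4 → Site 4 → Fin 4 → Site 4 → MKer 4 Unit} {Cv Cw Cx Cw' Cx' CwL CwL' cQ δ : ℝ} (hδ : 0 < δ)
    -- admissible-family letters, gluon sector
    (hV : ∀ (μ : Fin 4) (y : Site 4), BiLoc (V μ y) y y Cv δ) (hW : ∀ (μ : Fin 4) (y : Site 4) (ν : Fin 4) (y' : Site 4), BiLoc (W μ y ν y') y y' Cw δ)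
    (hcovV : ∀ (μ : Fin 4) (y t : Site 4), V μ (y + t) = shiftK (-t) (V μ y))
    (hcovW : ∀ (μ : Fin 4) (y : Site 4) (ν : Fin 4) (y' t : Site 4), W μ (y + t) ν (y' + t) = shiftK (-t) (W μ y ν y'))
    (X : Site 4 → MKer 4 (Fib 3)) (hX : ∀ y, BiLoc (X y) y y Cx δ)
    (hW1 : ∀ y, comp (comp Pker (divV V y)) Pker = comp Pker (X y) - comp (X y) Pker)
    (hW2 : ∀ y ν y', divW W y ν y' = comp (X y) (V ν y') - comp (V ν y') (X y))
    (hreflP : ∀ α : Fin 4, ∃ Φα : LegMap 4 (Fib 3), refK Φα Pker = Pker ∧ ∃ c : ℤ,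
      (∀ μ y, V μ (bondRefl α c μ y) = reflSign α μ • refK Φα (V μ y)) ∧
      (∀ μ y ν y', W μ (bondRefl α c μ y) ν (bondRefl α c ν y') = (reflSign α μ * reflSign α ν) • refK Φα (W μ y ν y')))
    (h0V : ∀ (lam α β : Fin 4), ∑' p : Pt × Pt, V lam 0 p.1 p.2 (Sum.inl α) (Sum.inl β) = 0)
    (hgermV : cubicGermOf V = cQ • bfGerm)
    (hWloc : ∀ (μ ν : Fin 4) (z : Pt), BiLoc (W μ 0 ν z) 0 z (CwL * Real.exp (-δ * l1 z)) δ)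
    -- admissible-family letters, ghost sector
    (hv : ∀ (μ : Fin 4) (y : Site 4), BiLoc (v μ y) y y Cv δ) (hw : ∀ (μ : Fin 4) (y : Site 4) (ν : Fin 4) (y' : Site 4), BiLoc (w μ y ν y') y y' Cw' δ)
    (hcovv : ∀ (μ : Fin 4) (y t : Site 4), v μ (y + t) = shiftK (-t) (v μ y))
    (hcovw : ∀ (μ : Fin 4) (y : Site 4) (ν : Fin 4) (y' t : Site 4), w μ (y + t) ν (y' + t) = shiftK (-t) (w μ y ν y'))
    (Xg : Site 4 → MKer 4 Unit) (hXg : ∀ y, BiLoc (Xg y) y y Cx' δ)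
    (hW1g : ∀ y, comp (comp G0ker (divV v y)) G0ker = comp G0ker (Xg y) - comp (Xg y) G0ker)
    (hW2g : ∀ y ν y', divW w y ν y' = comp (Xg y) (v ν y') - comp (v ν y') (Xg y))
    (hreflG : ∀ α : Fin 4, ∃ Ψα : LegMap 4 Unit, refK Ψα G0ker = G0ker ∧ ∃ c : ℤ,
      (∀ μ y, v μ (bondRefl α c μ y) = reflSign α μ • refK Ψα (v μ y)) ∧
      (∀ μ y ν y', w μ (bondRefl α c μ y) ν (bondRefl α c ν y') = (reflSign α μ * reflSign α ν) • refK Ψα (w μ y ν y')))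
    (h0v : ∀ lam : Fin 4, ∑' p : Pt × Pt, v lam 0 p.1 p.2 () () = 0)
    (hgermv : cubicGermOfSc v = ghostGerm)
    (hwloc : ∀ (μ ν : Fin 4) (z : Pt), BiLoc (w μ 0 ν z) 0 z (CwL' * Real.exp (-δ * l1 z)) δ)
    -- the colour weights and the entry
    {N : ℝ} (hn : (40 * wg * (1 / 4 : ℝ) * (c4 * cQ) ^ 2 - wgh * (-(1 / 2 : ℝ)) * c4 ^ 2) / 3 = kappaBal N)
    {μ ν : Fin 4} (hμν : μ ≠ ν)
    -- the split against the dressed truncated transport of `PiBF`, and the piece ledger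
    {T : ℕ → Fin 4 → Fin 4 → Pt → ℝ} {ι : Type*} (I : Finset ι) {D : ι → ℕ → Pt → ℝ} {B : ι → ℝ}
    (hsplit : ∀ m : ℕ, 1 ≤ m → ∀ u : Pt,
      T m μ ν u - ((Lc ^ m : ℕ) : ℝ) ^ 8 * dressedEntry (colOf (KPerf (d := 3) Lc (sfStep Lc) (smStep 3 Lc) m))
          (truncK (PiBF wg wgh V W v w) (Lc ^ m)) (((Lc ^ m : ℕ) : ℤ) • u) μ ν = ∑ i ∈ I, D i m u)
    (hpieces : ∀ i ∈ I, ∀ m : ℕ, 1 ≤ m → ∀ S : Finset Pt, ∑ u ∈ S, (supNorm u : ℝ) ^ 2 * |D i m u| ≤ B i) :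
    ∃ U₀ : ℝ, 0 ≤ U₀ ∧ ∃ Cg : ℝ, ∀ m : ℕ, 1 ≤ m →
      |B12Beta.secondMoment (T m) μ ν - (m : ℝ) * stepBal N Lc| ≤ (U₀ + ∑ i ∈ I, B i) + Cg := by
  -- module C's engine shapes of the cubic letters
  have hLoc : LocStencil V Cv δ := fun κ u => hV κ u
  have hcovV0 : ∀ (lam : Fin 4) (u : Site 4), V lam u = shiftK (-u) (V lam 0) := fun lam u => by
    have h := hcovV lam 0 u; rwa [zero_add] at h
  have hcovv0 : ∀ (lam : Fin 4) (u : Site 4), v lam u = shiftK (-u) (v lam 0) := fun lam u => by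
    have h := hcovv lam 0 u; rwa [zero_add] at h
  -- the four K-letters at `K := PiBF`
  obtain ⟨C, _, hK⟩ := sextic_PiBF (wg := wg) (wgh := wgh) (cQ := cQ) hδ hLoc hcovV0 h0V hgermV hWloc hv hcovv0 h0v hgermv hwloc
  have hcov : AxisReflectionCovariant (flipK (PiBF wg wgh V W v w)) :=
    axisReflectionCovariant_flipK_PiBF wg wgh hδ hV hW hcovV hcovW hreflP hv hw hcovv hcovw hreflG
  have hK0 : ∀ c e, HasSum (PiBF wg wgh V W v w c e) 0 :=
    hK0_PiBF wg wgh hδ hV hW hcovV hcovW X hX hW1 hW2 hv hw hcovv hcovw Xg hXg hW1g hW2g h0V hgermV hWloc h0v hgermv hwloc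
  obtain ⟨Cg, hgerm⟩ := hgerm_PiBF (wg := wg) (wgh := wgh) (cQ := cQ) hδ hLoc hcovV0 h0V hgermV hWloc hv hcovv0 h0v hgermv hwloc hn hμν
  -- the cov re-cut END
  obtain ⟨U₀, hU₀, hasym⟩ := hasym_perfect_of_pieces_cov hLc hK hcov hK0 (T := T) μ ν I hsplit hpieces hgerm
  refine ⟨U₀, hU₀, Cg, fun m hm => ?_⟩
  have h := hasym m hm
  rw [stepBal_eq]
  simpa using h

end Summit.QuantumFields.BalabanUV.Beta.FP.PerfectAsymptoticsBF

end
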